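import Summits.CriticalPhenomena.Ising3D.TaylorTableOddCoeffTMEntry
import Summits.CriticalPhenomena.Ising3D.TaylorTableOddCoeffRec
import Mathlib.Tactic.Linarith
import Mathlib.Tactic.Positivity
import Mathlib.Tactic.Ring
import HarnessLib

/-!
# The TABLE layer of a derivative certificate, XXIV: Taylor models in `Δ` of the REGULARISED Dolan–Osborn array over an `(a, b)` box
(cell `pub-ising3x`, seat boot-1 gen 8; gate (g2) — the coefficient models of the ODD head layer)

HONEST FRAMING: lottery ticket; floor = tightest certified 3D Ising CFT bounds; no exact-solution
claim without a proof. Island framing: certified exclusion region at stated derivative order and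
assumptions; not a determination of the 3D Ising critical exponents beyond that.

The odd head cells need, on a `Δ`-cell `Δ = A + ρ`, `|ρ| ≤ 2^{-e}`, and for `(a, b)` in a rational box
`[a₁, a₂] × [b₁, b₂]` (the families `(∓t/2, ±t/2)`, `t = Δσ − Δε` over the certificate box), Taylor models in `ρ` of the
REGULARISED coefficients `R_{n,j} = (Δ − b_ℓ) · A_{n,j}(a,b;Δ,ℓ)` (`A = hrCoeffAB`, `b_ℓ = unitarityBound3D ℓ`; the
regularisation of `TaylorTableOddCoeffRec` / `oddCoeffsReg`, which removes the pole of the pair `(1, ℓ−1)` at the unitarity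
bound so that cells may START at the bound). This file:
* `regAB a b Δ ℓ n j` — the regularised array as its OWN total recursion (level 0: `(Δ − b_ℓ)·δ_{jℓ}`; the pole entry
  `(1, ℓ−1)`, `ℓ ≥ 1`, in closed form `γ⁻_{Δ,ℓ}(a,b)/2`; every other entry by the Dolan–Osborn step; `0` off the descendant
  range) and **`regAB_eq`**: `b_ℓ < Δ → regAB = (Δ − b_ℓ) · hrCoeffAB` (so it IS `oddCoeffsReg`'s array);
* `HRTMAB.rows S A ℓ e D a₁ a₂ b₁ b₂ nF` — the Taylor-model table, levels `0 … nF`, built with the interval-numerator entry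
  `HRTMI.entryTMI` (the weights `γ^±_{E,j}(a,b) = c^±(u + ρ)(v + ρ)`, `u, v` affine in `a, b`, become interval quadratics),
  the pole entry as an exact interval quadratic, the same pivots / pivot check `HRTM.pivOK` as the equal-dimension file;
* **`HRTMAB.tmem_rows`**: `1 ≤ D`, `pivOK`, `a₁ ≤ a₂`, `b₁ ≤ b₂` ⇒ for all `(a, b)` in the box, every `ρ ↦ regAB a b (A+ρ) ℓ n j`,
  `n ≤ nF`, lies in its model on the cell — the coefficient half of the odd FAST head layer (cells = next file).
Sources: Dolan–Osborn 2004 §3 eqs. (3.11)–(3.13); Hogervorst–Rychkov 2013 §3; Makino–Berz Taylor models. Elementary. [folklore]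
-/

namespace Summit.CriticalPhenomena.Ising3D

open Finset
open Literature.Analysis.ValidatedNumerics Literature.Analysis.ValidatedNumerics.PolyMP
open Literature.Analysis.ValidatedNumerics.NumericsMP
open Literature.MathematicalPhysics.QuantumFieldTheory.ConformalBootstrap3D
open Literature.MathematicalPhysics.QuantumFieldTheory.ConformalBootstrap3D.HRTM
open Literature.MathematicalPhysics.QuantumFieldTheory.ConformalBootstrap3D.PointKernel (mulQ mem_mulQ)

/-! ### A. The regularised array as a total recursion -/

/-- **The regularised Dolan–Osborn array** `R_{n,j}(a,b;Δ,ℓ)`: `(Δ − b_ℓ)·δ_{jℓ}` at level `0`, the pole entry `(1, ℓ−1)`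
in closed form `γ⁻_{Δ,ℓ}(a,b)/2`, otherwise the recursion step of `hrCoeffAB`; `0` off the descendant range.
[cite: DolanOsborn2004, §3 eq. (3.12)] -/
noncomputable def regAB (a b Δ : ℝ) (ℓ : ℕ) : ℕ → ℕ → ℝ
  | 0, j => if j = ℓ then Δ - unitarityBound3D ℓ else 0
  | n + 1, j =>
      if InDescendantRange ℓ (n + 1) j then
        if n = 0 ∧ j + 1 = ℓ then hrGammaMinusAB a b Δ ℓ / 2
        else
          ((if j = 0 then 0 else hrGammaPlusAB a b (Δ + n) (j - 1) * regAB a b Δ ℓ n (j - 1)) +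
              hrGammaMinusAB a b (Δ + n) (j + 1) * regAB a b Δ ℓ n (j + 1)) /
            casimirPivot3D Δ ℓ (n + 1) j
      else 0

/-- Off the descendant range the regularised array vanishes. [folklore] -/
theorem regAB_eq_zero_of_not_inDescendantRange (a b Δ : ℝ) {ℓ n j : ℕ} (h : ¬ InDescendantRange ℓ n j) :
    regAB a b Δ ℓ n j = 0 := by
  cases n with
  | zero =>
    simp only [regAB]
    rw [if_neg]
    rintro rfl
    exact h ⟨by omega, by omega, by omega⟩
  | succ n => simp only [regAB, if_neg h]

/-- **The regularised array is `(Δ − b_ℓ)·A`** above the unitarity bound. [cite: DolanOsborn2004, §3 eq. (3.12)] -/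
theorem regAB_eq (a b : ℝ) {Δ : ℝ} {ℓ : ℕ} (hΔ : unitarityBound3D ℓ < Δ) :
    ∀ n j : ℕ, regAB a b Δ ℓ n j = (Δ - unitarityBound3D ℓ) * hrCoeffAB a b Δ ℓ n j := by
  intro n
  induction n with
  | zero =>
    intro j
    by_cases hj : j = ℓ
    · subst hj; simp [regAB]
    · simp [regAB, hj, hrCoeffAB_zero_of_ne a b Δ hj]
  | succ n ih =>
    intro j
    by_cases hR : InDescendantRange ℓ (n + 1) j
    · simp only [regAB, if_pos hR]
      by_cases hx : n = 0 ∧ j + 1 = ℓ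
      · rw [if_pos hx]
        obtain ⟨rfl, hjℓ⟩ := hx
        have hℓ : 1 ≤ ℓ := by omega
        obtain rfl : j = ℓ - 1 := by omega
        have hb : unitarityBound3D ℓ = (ℓ : ℝ) + 1 := by unfold unitarityBound3D; rw [if_neg (by omega)]
        have hne : Δ - (ℓ : ℝ) - 1 ≠ 0 := by rw [hb] at hΔ; intro h; linarith
        rw [reg_pole_pos hℓ hne, hrGammaMinusAB, div_div]
        ring
      · rw [if_neg hx, hrCoeffAB_succ, ih, ih]
        by_cases hj0 : j = 0
        · simp only [hj0, if_true, zero_add]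
          rw [mul_div_assoc]; ring
        · simp only [if_neg hj0]
          rw [show (Δ - unitarityBound3D ℓ) *
              ((hrGammaPlusAB a b (Δ + ↑n) (j - 1) * hrCoeffAB a b Δ ℓ n (j - 1) +
                  hrGammaMinusAB a b (Δ + ↑n) (j + 1) * hrCoeffAB a b Δ ℓ n (j + 1)) /
                casimirPivot3D Δ ℓ (n + 1) j) =
              (hrGammaPlusAB a b (Δ + ↑n) (j - 1) * ((Δ - unitarityBound3D ℓ) * hrCoeffAB a b Δ ℓ n (j - 1)) +
                  hrGammaMinusAB a b (Δ + ↑n) (j + 1) * ((Δ - unitarityBound3D ℓ) * hrCoeffAB a b Δ ℓ n (j + 1))) /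
                casimirPivot3D Δ ℓ (n + 1) j by rw [mul_div_assoc']; ring_nf]
    · rw [regAB_eq_zero_of_not_inDescendantRange a b Δ hR, hrCoeffAB_eq_zero_of_not_inDescendantRange a b Δ hR,
        mul_zero]

/-- The in-range, non-pole step of `regAB`, multiplied through by the pivot. [cite: DolanOsborn2004, §3 eq. (3.12)] -/
theorem regAB_succ_rec {a b Δ : ℝ} {ℓ n j : ℕ} (hR : InDescendantRange ℓ (n + 1) j) (hx : ¬ (n = 0 ∧ j + 1 = ℓ))
    (hp : casimirPivot3D Δ ℓ (n + 1) j ≠ 0) :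
    casimirPivot3D Δ ℓ (n + 1) j * regAB a b Δ ℓ (n + 1) j =
      (if j = 0 then 0 else hrGammaPlusAB a b (Δ + n) (j - 1) * regAB a b Δ ℓ n (j - 1)) +
        hrGammaMinusAB a b (Δ + n) (j + 1) * regAB a b Δ ℓ n (j + 1) := by
  conv_lhs => rw [regAB]
  rw [if_pos hR, if_neg hx, mul_div_cancel₀ _ hp]

/-! ### B. The interval weights -/

namespace HRTMAB

/-- The point interval of a rational at scale `S` widened to `[q₁, q₂]`. [folklore] -/
def ivlQ (S : ℕ) (q₁ q₂ : ℚ) : MI := MI.span (ofRat S q₁) (ofRat S q₂)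

/-- [folklore] -/
theorem mem_ivlQ (S : ℕ) {q₁ q₂ : ℚ} {x : ℝ} (h1 : (q₁ : ℝ) ≤ x) (h2 : x ≤ q₂) : MI.mem S x (ivlQ S q₁ q₂) :=
  MI.mem_span (mem_ofRat S q₁) (mem_ofRat S q₂) h1 h2

/-- The three interval coefficients of `c·(u + ρ)(v + ρ)` with `u ∈ [α + 2a₁, α + 2a₂]`, `v ∈ [α + 2b₁, α + 2b₂]`:
`(G₀, G₁, G₂) = (c·U·V, c·(U + V), c)`. [folklore] -/
def quadI (S : ℕ) (c α a₁ a₂ b₁ b₂ : ℚ) : MI × MI × MI :=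
  let U := ivlQ S (α + 2 * a₁) (α + 2 * a₂)
  let V := ivlQ S (α + 2 * b₁) (α + 2 * b₂)
  (mulQ (MI.mul S U V) c, mulQ (MI.add U V) c, ofRat S c)

/-- **Membership of the real coefficients** of `c(α + 2a + ρ)(α + 2b + ρ)` in `quadI`. [folklore] -/
theorem mem_quadI {S : ℕ} (hS : 0 < S) (c α : ℚ) {a₁ a₂ b₁ b₂ : ℚ} {a b : ℝ} (ha : (a₁ : ℝ) ≤ a ∧ a ≤ a₂)
    (hb : (b₁ : ℝ) ≤ b ∧ b ≤ b₂) :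
    MI.mem S ((c : ℝ) * (((α : ℝ) + 2 * a) * ((α : ℝ) + 2 * b))) (quadI S c α a₁ a₂ b₁ b₂).1 ∧
      MI.mem S ((c : ℝ) * (((α : ℝ) + 2 * a) + ((α : ℝ) + 2 * b))) (quadI S c α a₁ a₂ b₁ b₂).2.1 ∧
      MI.mem S (c : ℝ) (quadI S c α a₁ a₂ b₁ b₂).2.2 := by
  have hu : MI.mem S ((α : ℝ) + 2 * a) (ivlQ S (α + 2 * a₁) (α + 2 * a₂)) :=
    mem_ivlQ S (by push_cast; linarith [ha.1]) (by push_cast; linarith [ha.2])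
  have hv : MI.mem S ((α : ℝ) + 2 * b) (ivlQ S (α + 2 * b₁) (α + 2 * b₂)) :=
    mem_ivlQ S (by push_cast; linarith [hb.1]) (by push_cast; linarith [hb.2])
  refine ⟨?_, ?_, mem_ofRat S c⟩
  · have := mem_mulQ (MI.mem_mul hS hu hv) c
    simpa [quadI, mul_comm] using this
  · have := mem_mulQ (MI.mem_add hu hv) c
    simpa [quadI, mul_comm] using this

/-! ### C. The Taylor-model rows of the regularised array -/

/-- The exact interval quadratic of the pole entry `R_{1,ℓ−1}(A+ρ) = (A−ℓ−1+2a+ρ)(A−ℓ−1+2b+ρ)·ℓ/(2(2ℓ+1))`. [cite: DolanOsborn2004, §3 eq. (3.12)] -/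
def poleTM (S : ℕ) (A : ℚ) (ℓ : ℕ) (a₁ a₂ b₁ b₂ : ℚ) : IPoly :=
  let G := quadI S ((ℓ : ℚ) / (2 * (2 * ℓ + 1))) (A - ℓ - 1) a₁ a₂ b₁ b₂
  [G.1, G.2.1, G.2.2]

/-- One entry of level `n+1` from the row of level `n`. [cite: DolanOsborn2004, §3 eq. (3.12)] -/
def stepEntry (S : ℕ) (A : ℚ) (ℓ e D : ℕ) (a₁ a₂ b₁ b₂ : ℚ) (n j : ℕ) (row : List IPoly) : IPoly :=
  if InDescendantRange ℓ (n + 1) j then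
    if n = 0 ∧ j + 1 = ℓ then poleTM S A ℓ a₁ a₂ b₁ b₂
    else
      let Gp := quadI S (if j = 0 then 0 else (j : ℚ) / (2 * j - 1)) (A + n + j - 1) a₁ a₂ b₁ b₂
      let Gm := quadI S (((j : ℚ) + 1) / (2 * j + 3)) (A + n - j - 2) a₁ a₂ b₁ b₂
      HRTMI.entryTMI S e D Gp.1 Gp.2.1 Gp.2.2 Gm.1 Gm.2.1 Gm.2.2 (p0Q A ℓ n j) (p1Q n)
        (if j = 0 then [] else row.getD (j - 1) []) (row.getD (j + 1) [])
  else []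

/-- The row of level `n+1`. [folklore] -/
def stepRow (S : ℕ) (A : ℚ) (ℓ e D : ℕ) (a₁ a₂ b₁ b₂ : ℚ) (n : ℕ) (row : List IPoly) : List IPoly :=
  vtab (ℓ + n + 2) fun j => stepEntry S A ℓ e D a₁ a₂ b₁ b₂ n j row

/-- Rows of levels `nF, …, 0` (newest first); level `0` is the exact linear model `(A − b_ℓ) + ρ` at `j = ℓ`. [folklore] -/
def rows (S : ℕ) (A : ℚ) (ℓ e D : ℕ) (a₁ a₂ b₁ b₂ : ℚ) : ℕ → List (List IPoly)
  | 0 => [vtab (ℓ + 1) fun j => if j = ℓ then [ofRat S (A - bQ ℓ), ofRat S 1] else []]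
  | n + 1 =>
      let rs := rows S A ℓ e D a₁ a₂ b₁ b₂ n
      stepRow S A ℓ e D a₁ a₂ b₁ b₂ n (rs.headD []) :: rs

/-! ### D. Soundness -/

/-- The box condition on `(a, b)`. [folklore] -/
def InBox (a₁ a₂ b₁ b₂ : ℚ) (a b : ℝ) : Prop := ((a₁ : ℝ) ≤ a ∧ a ≤ a₂) ∧ ((b₁ : ℝ) ≤ b ∧ b ≤ b₂)

/-- The pole entry's model is exact. [cite: DolanOsborn2004, §3 eq. (3.12)] -/
theorem tmem_poleTM {S : ℕ} (hS : 0 < S) (h : ℚ) (A : ℚ) {ℓ : ℕ} (hℓ : 1 ≤ ℓ) {a₁ a₂ b₁ b₂ : ℚ} {a b : ℝ}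
    (hab : InBox a₁ a₂ b₁ b₂ a b) :
    TMem S h (fun ρ => regAB a b ((A : ℝ) + ρ) ℓ 1 (ℓ - 1)) (poleTM S A ℓ a₁ a₂ b₁ b₂) := by
  intro ρ _
  obtain ⟨m0, m1, m2⟩ := mem_quadI hS ((ℓ : ℚ) / (2 * (2 * ℓ + 1))) (A - ℓ - 1) hab.1 hab.2
  refine ⟨[_, _, _], pmem_cons m0 (pmem_cons m1 (pmem_cons m2 (pmem_nil S))), ?_⟩
  have hR : InDescendantRange ℓ (0 + 1) (ℓ - 1) := ⟨by omega, by omega, by omega⟩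
  show regAB a b ((A : ℝ) + ρ) ℓ (0 + 1) (ℓ - 1) = _
  rw [regAB, if_pos hR, if_pos ⟨rfl, by omega⟩, hrGammaMinusAB]
  simp only [evalR_cons, evalR_nil, mul_zero, add_zero]
  have h2 : (2 : ℝ) * (ℓ : ℝ) + 1 ≠ 0 := by positivity
  push_cast
  field_simp
  ring

set_option maxRecDepth 16384 in
/-- **Soundness of one recursion step** (non-exceptional in-range pair). [cite: DolanOsborn2004, §3 eq. (3.12)] -/
theorem tmem_stepEntry_rec {S : ℕ} (hS : 0 < S) {A : ℚ} {ℓ e D n j : ℕ} {a₁ a₂ b₁ b₂ : ℚ} {a b : ℝ}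
    (hab : InBox a₁ a₂ b₁ b₂ a b) {row : List IPoly}
    (hrow : ∀ j', TMem S ((1 : ℚ) / 2 ^ e) (fun ρ => regAB a b ((A : ℝ) + ρ) ℓ n j') (row.getD j' []))
    (hlen : ∀ j', (row.getD j' []).length ≤ D + 1) (hR : InDescendantRange ℓ (n + 1) j)
    (hx : ¬ (n = 0 ∧ j + 1 = ℓ)) (hm : 0 < pivMargin e (p0Q A ℓ n j) (p1Q n)) :
    TMem S ((1 : ℚ) / 2 ^ e) (fun ρ => regAB a b ((A : ℝ) + ρ) ℓ (n + 1) j)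
      (stepEntry S A ℓ e D a₁ a₂ b₁ b₂ n j row) := by
  rw [stepEntry, if_pos hR, if_neg hx]
  have hh : ((((1 : ℚ) / 2 ^ e : ℚ)) : ℝ) = 1 / 2 ^ e := by push_cast; ring
  obtain ⟨p0m, p1m, p2m⟩ := mem_quadI hS (if j = 0 then 0 else (j : ℚ) / (2 * j - 1)) (A + n + j - 1) hab.1 hab.2
  obtain ⟨q0m, q1m, q2m⟩ := mem_quadI hS (((j : ℚ) + 1) / (2 * j + 3)) (A + n - j - 2) hab.1 hab.2
  -- pivot non-vanishing on the cell
  have hp : ∀ ρ : ℝ, |ρ| ≤ 1 / 2 ^ e → casimirPivot3D ((A : ℝ) + ρ) ℓ (n + 1) j ≠ 0 := by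
    intro ρ hρ
    rw [HRTM.casimirPivot3D_eq]
    have h1 := pivMargin_le_abs (p0Q A ℓ n j) (p1Q n) hρ
    have h2 : ((pivMargin e (p0Q A ℓ n j) (p1Q n) : ℚ) : ℝ) = |(p0Q A ℓ n j : ℝ)| - |(p1Q n : ℝ)| / 2 ^ e := by
      simp only [pivMargin]; push_cast; ring
    have h3 : (0 : ℝ) < |(p0Q A ℓ n j : ℝ)| - |(p1Q n : ℝ)| / 2 ^ e := by rw [← h2]; exact_mod_cast hm
    intro h0; rw [h0, abs_zero] at h1; linarith
  by_cases hj : j = 0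
  · subst hj
    simp only [if_true] at p0m p1m p2m ⊢
    refine HRTMI.tmem_entryI hS p0m p1m p2m q0m q1m q2m (fp := fun _ => 0) (tmem_nil_zero S _) (hrow 1) (by simp)
      (hlen 1) hm ?_
    intro ρ hρ
    rw [hh] at hρ
    have hrec := regAB_succ_rec (a := a) (b := b) hR hx (hp ρ hρ)
    rw [HRTM.casimirPivot3D_eq] at hrec
    rw [hrec, if_pos rfl, hrGammaMinusAB]
    push_cast; ring
  · obtain ⟨j', rfl⟩ : ∃ j', j = j' + 1 := ⟨j - 1, by omega⟩
    simp only [Nat.add_sub_cancel, if_neg (Nat.succ_ne_zero j')] at p0m p1m p2m ⊢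
    refine HRTMI.tmem_entryI hS p0m p1m p2m q0m q1m q2m (hrow j') (hrow (j' + 1 + 1)) (hlen j')
      (hlen (j' + 1 + 1)) hm ?_
    intro ρ hρ
    rw [hh] at hρ
    have hrec := regAB_succ_rec (a := a) (b := b) hR hx (hp ρ hρ)
    rw [HRTM.casimirPivot3D_eq] at hrec
    rw [hrec, if_neg (Nat.succ_ne_zero j'), Nat.add_sub_cancel, hrGammaPlusAB, hrGammaMinusAB]
    have h1 : (2 : ℝ) * (j' : ℝ) + 1 ≠ 0 := by positivity
    have h3 : (2 : ℝ) * ((j' : ℝ) + 1 + 1) + 1 ≠ 0 := by positivity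
    have h1' : (2 : ℝ) * ((j' : ℝ) + 1) - 1 ≠ 0 := by
      rw [show (2 : ℝ) * ((j' : ℝ) + 1) - 1 = 2 * (j' : ℝ) + 1 by ring]; exact h1
    have h3' : (2 : ℝ) * ((j' : ℝ) + 1) + 3 ≠ 0 := by positivity
    push_cast
    field_simp
    ring

/-- [folklore] -/
theorem length_poleTM (S : ℕ) (A : ℚ) (ℓ : ℕ) (a₁ a₂ b₁ b₂ : ℚ) : (poleTM S A ℓ a₁ a₂ b₁ b₂).length = 3 := rfl

/-- The invariant: every stored entry encloses the regularised coefficient and has degree `≤ D`. [folklore] -/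
def RowsOK (S : ℕ) (A : ℚ) (ℓ e D : ℕ) (a b : ℝ) (nF : ℕ) (rs : List (List IPoly)) : Prop :=
  ∀ n ≤ nF, ∀ j, TMem S ((1 : ℚ) / 2 ^ e) (fun ρ => regAB a b ((A : ℝ) + ρ) ℓ n j) (rowEntry rs nF n j) ∧
    (rowEntry rs nF n j).length ≤ D + 1

/-- **Soundness of the Taylor-model recursion for the regularised array.** [cite: DolanOsborn2004, §3 eq. (3.12)] -/
theorem rows_ok {S : ℕ} (hS : 0 < S) (A : ℚ) (ℓ e D : ℕ) (hD : 2 ≤ D) {a₁ a₂ b₁ b₂ : ℚ} {a b : ℝ}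
    (hab : InBox a₁ a₂ b₁ b₂ a b) :
    ∀ nF, PivCond A ℓ e nF → RowsOK S A ℓ e D a b nF (rows S A ℓ e D a₁ a₂ b₁ b₂ nF) := by
  intro nF
  induction nF with
  | zero =>
    intro _ n hn j
    obtain rfl : n = 0 := Nat.le_zero.mp hn
    simp only [rowEntry, rows, Nat.sub_zero, List.getD_cons_zero, getD_vtab]
    by_cases hj : j < ℓ + 1
    · rw [if_pos hj]
      by_cases hjl : j = ℓ
      · subst hjl
        rw [if_pos rfl]
        refine ⟨fun ρ _ => ⟨[((A - bQ j : ℚ) : ℝ), ((1 : ℚ) : ℝ)],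
          pmem_cons (mem_ofRat S _) (pmem_cons (mem_ofRat S _) (pmem_nil S)), ?_⟩, by simp; omega⟩
        simp only [regAB, if_true, evalR_cons, evalR_nil, mul_zero, add_zero]
        rw [← cast_bQ]; push_cast; ring
      · rw [if_neg hjl]
        exact ⟨tmem_nil_of_eq_zero fun ρ => by simp [regAB, hjl], by simp⟩
    · rw [if_neg hj]
      have hjl : j ≠ ℓ := by omega
      exact ⟨tmem_nil_of_eq_zero fun ρ => by simp [regAB, hjl], by simp⟩
  | succ nF ih =>
    intro hpc n hn j
    have hpc' : PivCond A ℓ e nF := fun n hn j hj => hpc n (Nat.lt_succ_of_lt hn) j hj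
    have ih' := ih hpc'
    by_cases hle : n ≤ nF
    · have e1 : rowEntry (rows S A ℓ e D a₁ a₂ b₁ b₂ (nF + 1)) (nF + 1) n j =
          rowEntry (rows S A ℓ e D a₁ a₂ b₁ b₂ nF) nF n j := by
        simp only [rowEntry, rows, show nF + 1 - n = (nF - n) + 1 by omega, List.getD_cons_succ]
      rw [e1]; exact ih' n hle j
    · obtain rfl : n = nF + 1 := by omega
      set row : List IPoly := (rows S A ℓ e D a₁ a₂ b₁ b₂ nF).getD 0 [] with hrowdef
      have hrow : ∀ j', TMem S ((1 : ℚ) / 2 ^ e) (fun ρ => regAB a b ((A : ℝ) + ρ) ℓ nF j') (row.getD j' []) :=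
        fun j' => by simpa [rowEntry, hrowdef] using (ih' nF le_rfl j').1
      have hlen : ∀ j', (row.getD j' []).length ≤ D + 1 :=
        fun j' => by simpa [rowEntry, hrowdef] using (ih' nF le_rfl j').2
      have e1 : rowEntry (rows S A ℓ e D a₁ a₂ b₁ b₂ (nF + 1)) (nF + 1) (nF + 1) j =
          (stepRow S A ℓ e D a₁ a₂ b₁ b₂ nF row).getD j [] := by
        simp only [rowEntry, rows, Nat.sub_self, List.getD_cons_zero, headD_eq_getD_zero, hrowdef]
      rw [e1, stepRow, getD_vtab]
      by_cases hj : j < ℓ + nF + 2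
      · rw [if_pos hj]
        by_cases hR : InDescendantRange ℓ (nF + 1) j
        · by_cases hx : nF = 0 ∧ j + 1 = ℓ
          · rw [stepEntry, if_pos hR, if_pos hx]
            obtain ⟨rfl, hjℓ⟩ := hx
            have hℓ : 1 ≤ ℓ := by omega
            obtain rfl : j = ℓ - 1 := by omega
            exact ⟨tmem_poleTM hS _ A hℓ hab, by rw [length_poleTM]; omega⟩
          · refine ⟨tmem_stepEntry_rec hS hab hrow hlen hR hx (hpc nF (Nat.lt_succ_self _) j hj hR hx), ?_⟩
            rw [stepEntry, if_pos hR, if_neg hx]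
            exact (HRTMI.length_entryTMI _ _ _ _ _ _ _ _ _ _ _ _ _).le
        · rw [stepEntry, if_neg hR]
          exact ⟨tmem_nil_of_eq_zero fun ρ => regAB_eq_zero_of_not_inDescendantRange _ _ _ hR, by simp⟩
      · rw [if_neg hj]
        have hR : ¬ InDescendantRange ℓ (nF + 1) j := by
          intro h; obtain ⟨_, h2, _⟩ := h; omega
        exact ⟨tmem_nil_of_eq_zero fun ρ => regAB_eq_zero_of_not_inDescendantRange _ _ _ hR, by simp⟩

/-- **Kernel-facing corollary**: the Taylor model of `ρ ↦ (Δ − b_ℓ) A_{n,j}(a,b; A+ρ, ℓ)` for every `(a, b)` in the box.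
[cite: DolanOsborn2004, §3 eq. (3.12)] -/
theorem tmem_rows {S : ℕ} (hS : 0 < S) {A : ℚ} {ℓ e D nF : ℕ} (hD : 2 ≤ D) (hpiv : pivOK A ℓ e nF = true)
    {a₁ a₂ b₁ b₂ : ℚ} {a b : ℝ} (hab : InBox a₁ a₂ b₁ b₂ a b) {n : ℕ} (hn : n ≤ nF) (j : ℕ) :
    TMem S ((1 : ℚ) / 2 ^ e) (fun ρ => regAB a b ((A : ℝ) + ρ) ℓ n j)
      (rowEntry (rows S A ℓ e D a₁ a₂ b₁ b₂ nF) nF n j) :=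
  (rows_ok hS A ℓ e D hD hab nF (pivCond_of_pivOK hpiv) n hn j).1

/-- Degree bound of the stored models. [folklore] -/
theorem length_rowEntry_le {S : ℕ} (hS : 0 < S) {A : ℚ} {ℓ e D nF : ℕ} (hD : 2 ≤ D) (hpiv : pivOK A ℓ e nF = true)
    {a₁ a₂ b₁ b₂ : ℚ} {a b : ℝ} (hab : InBox a₁ a₂ b₁ b₂ a b) {n : ℕ} (hn : n ≤ nF) (j : ℕ) :
    (rowEntry (rows S A ℓ e D a₁ a₂ b₁ b₂ nF) nF n j).length ≤ D + 1 :=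
  (rows_ok hS A ℓ e D hD hab nF (pivCond_of_pivOK hpiv) n hn j).2

end HRTMAB

end Summit.CriticalPhenomena.Ising3D
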